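import Mathlib.Topology.Algebra.OpenSubgroup
import Mathlib.Topology.Algebra.ClopenNhdofOne
import Mathlib.Topology.Bases
import Mathlib.Order.Filter.CountablyGenerated
import Literature.AnabelianGeometry.AbsoluteAnabelian.FundamentalExtension
import HarnessLib

/-!
# Galois-countability of an extension `1 → Δ → Π → G → 1` of profinite groups ([IUTchI] Rmk 2.5.3 (ii) (E2))

Mochizuki, *Inter-universal Teichmüller theory I*, Remark 2.5.3 (ii) (E2), kurims manuscript (May
2020) p. 53: "if `k` is a field whose absolute Galois group is Galois-countable, and `U` is [the interior
of a proper log smooth log scheme over `k`], then the tamely ramified arithmetic fundamental group of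
`U` … is itself Galois-countable [cf., e.g., [AbsTopI], Proposition 2.2]" — i.e. (with [AbsTopI] Prop.
2.2: the geometric fundamental group `Δ` is topologically finitely generated) the middle term of
`1 → Δ → Π → G_k → 1` has a countable basis as soon as `G_k` does.  This Mathlib-only file (plus the
tree's `IsTopologicallyFinitelyGenerated` / `FundamentalExtension`, abc-iut-L4) PROVES the
group-topological content (abc-iut cell, layer L5, abc-iut-L5-t6):

* `secondCountableTopology_of_iInf_eq_bot` — a compact topological group with a COUNTABLE family of
  open subgroups with trivial intersection is second countable (cosets of finite intersections form a
  countable basis; compactness turns "trivial intersection" into "cofinal among neighbourhoods of 1").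
* `secondCountableTopology_of_extension` — for a continuous homomorphism `f : A → B` of profinite
  groups with `B` second countable and `Ker f` having only countably many open subgroups, `A` is second
  countable (open normal subgroups of `A`, chosen one per trace on `Ker f`, together with the preimages
  of a countable cofinal family of open normal subgroups of `B`, separate points).
* `FundamentalExtension.secondCountableTopology_arith` — for abc-iut-L4-t1's `1 → Δ → Π → G → 1`: if
  `Δ = E.geom` has countably many open subgroups (e.g. if it is topologically finitely generated,
  [AbsTopI] Prop. 2.2 / `GeomTFG`, by `TopFGOpenSubgroups.lean`) and `G = E.gal` is second countable,
  then `Π = E.arith` is second countable — the printed (E2) inference (composed with [AbsTopI] Prop.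
  2.2 in `IUT/HodgeTheaters/CoveringsErrataProofs.lean`).

Elementary; no side is taken on [IUTchIII] Cor. 3.12.
-/

open scoped Pointwise
open Topology TopologicalSpace Filter

namespace Literature.AnabelianGeometry.AbsoluteAnabelian

universe u v

section CompactGroup

variable {G : Type u} [Group G] [TopologicalSpace G] [IsTopologicalGroup G] [CompactSpace G]

/-- In a compact topological group, a countable family of open subgroups with trivial intersection
yields a countable basis: the cosets of the finite intersections.  [IUTchI] Rmk. 2.5.3 (i) (T1)
"Galois-countable" = "its topology admits a countable basis". [cite: Mochizuki2012, IUTchI Rmk 2.5.3 (ii) (E2) p.53] -/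
theorem secondCountableTopology_of_iInf_eq_bot {ι : Type v} [Countable ι] (N : ι → Subgroup G)
    (hN : ∀ i, IsOpen (N i : Set G)) (hsep : ∀ x : G, (∀ i, x ∈ N i) → x = 1) :
    SecondCountableTopology G := by
  classical
  -- finite intersections
  let F : Finset ι → Subgroup G := fun s => ⨅ i ∈ s, N i
  have hFopen : ∀ s, IsOpen (F s : Set G) := by
    intro s
    have : (F s : Set G) = ⋂ i ∈ s, (N i : Set G) := by
      simp only [F, Subgroup.coe_iInf]
    rw [this]
    exact isOpen_biInter_finset fun i _ => hN i
  have hcoset : ∀ (s : Finset ι) (a : G),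
      IsOpen ((QuotientGroup.mk : G → G ⧸ F s) ⁻¹' {(a : G ⧸ F s)}) := by
    intro s a
    have : (QuotientGroup.mk : G → G ⧸ F s) ⁻¹' {(a : G ⧸ F s)} =
        (fun g => a⁻¹ * g) ⁻¹' (F s : Set G) := by
      ext g
      simp only [Set.mem_preimage, Set.mem_singleton_iff, SetLike.mem_coe]
      rw [QuotientGroup.eq, ← (F s).inv_mem_iff, mul_inv_rev, inv_inv]
    rw [this]
    exact (hFopen s).preimage (continuous_const.mul continuous_id)
  let B : Set (Set G) :=
    ⋃ s : Finset ι, Set.range fun q : G ⧸ F s => (QuotientGroup.mk : G → G ⧸ F s) ⁻¹' {q}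
  have hBc : B.Countable := by
    refine Set.countable_iUnion fun s => ?_
    haveI : Finite (G ⧸ F s) := (F s).quotient_finite_of_isOpen (hFopen s)
    exact Set.countable_range _
  have hBasis : IsTopologicalBasis B := by
    apply isTopologicalBasis_of_isOpen_of_nhds
    · intro S hS
      obtain ⟨s, q, rfl⟩ := Set.mem_iUnion.mp hS
      obtain ⟨a, rfl⟩ := QuotientGroup.mk_surjective q
      exact hcoset s a
    · intro a O haO hO
      -- `U := a⁻¹ O` is an open neighbourhood of `1`; some finite intersection `F s` lies inside it
      let U : Set G := (fun g => a * g) ⁻¹' O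
      have hU : IsOpen U := hO.preimage (continuous_const.mul continuous_id)
      have h1U : (1 : G) ∈ U := by simp [U, haO]
      have hcpt : IsCompact Uᶜ := hU.isClosed_compl.isCompact
      have hempty : (Uᶜ ∩ ⋂ i, (N i : Set G)) = ∅ := by
        ext x
        simp only [Set.mem_inter_iff, Set.mem_compl_iff, Set.mem_iInter, SetLike.mem_coe,
          Set.mem_empty_iff_false, iff_false, not_and, not_forall]
        intro hx
        by_contra hall
        push Not at hall
        exact hx (hsep x hall ▸ h1U)
      obtain ⟨s, hs⟩ := hcpt.elim_finite_subfamily_closed (fun i => (N i : Set G))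
        (fun i => Subgroup.isClosed_of_isOpen _ (hN i)) hempty
      have hFU : (F s : Set G) ⊆ U := by
        intro x hx
        by_contra hxU
        have : x ∈ Uᶜ ∩ ⋂ i ∈ s, (N i : Set G) := by
          refine ⟨hxU, ?_⟩
          have hx' : x ∈ ⋂ i ∈ s, (N i : Set G) := by
            rw [← Subgroup.coe_iInf] at *
            simpa [F] using hx
          exact hx'
        rw [hs] at this
        exact this
      refine ⟨(QuotientGroup.mk : G → G ⧸ F s) ⁻¹' {(a : G ⧸ F s)},
        Set.mem_iUnion.mpr ⟨s, (a : G ⧸ F s), rfl⟩, rfl, ?_⟩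
      intro g hg
      simp only [Set.mem_preimage, Set.mem_singleton_iff] at hg
      have hag : a⁻¹ * g ∈ F s := QuotientGroup.eq.mp hg.symm
      have := hFU hag
      simpa [U] using this
  exact ⟨⟨B, hBc, hBasis.eq_generateFrom⟩⟩

end CompactGroup

section Extension

variable {A : Type u} [Group A] [TopologicalSpace A] [IsTopologicalGroup A] [CompactSpace A]
  [TotallyDisconnectedSpace A]
variable {B : Type v} [Group B] [TopologicalSpace B] [IsTopologicalGroup B] [CompactSpace B]
  [TotallyDisconnectedSpace B] [T1Space B]

/-- In a profinite group, every point other than `1` is avoided by some open normal subgroup.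
[cite: Mochizuki2012, IUTchI Rmk 2.5.3 (ii) (E2) p.53] -/
theorem exists_openNormalSubgroup_not_mem [T1Space A] {x : A} (hx : x ≠ 1) :
    ∃ N : OpenNormalSubgroup A, x ∉ N := by
  obtain ⟨N, hN⟩ := ProfiniteGrp.exist_openNormalSubgroup_sub_open_nhds_of_one
    (isOpen_compl_singleton (x := x)) (by simpa using hx.symm)
  exact ⟨N, fun h => hN h rfl⟩

/-- **Second countability of profinite extensions.**  Let `f : A → B` be a continuous homomorphism of
profinite groups with `B` second countable, and suppose the kernel of `f` (with the subspace topology)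
has only countably many open subgroups.  Then `A` is second countable.
[cite: Mochizuki2012, IUTchI Rmk 2.5.3 (ii) (E2) p.53] -/
theorem secondCountableTopology_of_extension [T1Space A] [SecondCountableTopology B] (f : A →ₜ* B)
    (hK : {U : Subgroup f.toMonoidHom.ker | IsOpen (U : Set f.toMonoidHom.ker)}.Countable) :
    SecondCountableTopology A := by
  classical
  set K : Subgroup A := f.toMonoidHom.ker with hKdef
  -- (1) a countable cofinal family of open normal subgroups of `B`
  obtain ⟨u, hu⟩ := (𝓝 (1 : B)).exists_antitone_basis
  have hNB : ∀ n : ℕ, ∃ N : OpenNormalSubgroup B, (N : Set B) ⊆ u n := by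
    intro n
    have hn : u n ∈ 𝓝 (1 : B) := hu.mem n
    obtain ⟨N, hN⟩ := ProfiniteGrp.exist_openNormalSubgroup_sub_open_nhds_of_one
      (isOpen_interior (s := u n)) (mem_interior_iff_mem_nhds.mpr hn)
    exact ⟨N, hN.trans interior_subset⟩
  choose NB hNB using hNB
  -- (2) one open normal subgroup of `A` per trace on the kernel
  let S : Type u := {U : Subgroup K // IsOpen (U : Set K)}
  haveI : Countable S := hK.to_subtype
  have htr : ∀ U : S, ∃ N : OpenNormalSubgroup A,
      (∃ N₀ : OpenNormalSubgroup A, (N₀ : Subgroup A).subgroupOf K = U.1) →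
        (N : Subgroup A).subgroupOf K = U.1 := by
    intro U
    by_cases h : ∃ N₀ : OpenNormalSubgroup A, (N₀ : Subgroup A).subgroupOf K = U.1
    · obtain ⟨N₀, hN₀⟩ := h
      exact ⟨N₀, fun _ => hN₀⟩
    · exact ⟨{ toOpenSubgroup := ⊤, isNormal' := Subgroup.normal_of_characteristic ⊤ }, fun h' => (h h').elim⟩
  choose NA hNA using htr
  -- the combined countable family of open subgroups of `A`
  let Fam : ℕ ⊕ S → Subgroup A := fun j =>
    match j with
    | Sum.inl n => ((NB n : Subgroup B)).comap f.toMonoidHom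
    | Sum.inr U => (NA U : Subgroup A)
  refine secondCountableTopology_of_iInf_eq_bot Fam ?_ ?_
  · rintro (n | U)
    · exact (NB n).isOpen'.preimage f.continuous
    · exact (NA U).isOpen'
  · intro x hx
    -- `f x` lies in every `NB n`, hence in every neighbourhood of `1`: `f x = 1`
    have hfx : f x = 1 := by
      by_contra hne
      have hmem : {f x}ᶜ ∈ 𝓝 (1 : B) := isOpen_compl_singleton.mem_nhds (by simpa using fun h => hne h.symm)
      obtain ⟨n, hn⟩ := hu.mem_iff.mp hmem
      have : f x ∈ u n := hNB n (hx (Sum.inl n))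
      exact hn this rfl
    have hxK : x ∈ K := hfx
    -- if `x ≠ 1`, an open normal subgroup of `A` avoids it, and so does the chosen one with the
    -- same trace on `K`
    by_contra hx1
    obtain ⟨N₀, hxN₀⟩ := exists_openNormalSubgroup_not_mem hx1
    let U₀ : S := ⟨(N₀ : Subgroup A).subgroupOf K,
      (N₀.isOpen'.preimage continuous_subtype_val)⟩
    have htrace : (NA U₀ : Subgroup A).subgroupOf K = (N₀ : Subgroup A).subgroupOf K :=
      hNA U₀ ⟨N₀, rfl⟩
    have hxNA : x ∈ (NA U₀ : Subgroup A) := hx (Sum.inr U₀)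
    have : (⟨x, hxK⟩ : K) ∈ (N₀ : Subgroup A).subgroupOf K := by
      rw [← htrace, Subgroup.mem_subgroupOf]
      exact hxNA
    exact hxN₀ (Subgroup.mem_subgroupOf.mp this)

end Extension

/-! ### The printed (E2) inference for `1 → Δ → Π → G → 1` -/

namespace FundamentalExtension

/-- **[IUTchI] Remark 2.5.3 (ii) (E2)**, PROVED over abc-iut-L4-t1's interface: if the geometric
fundamental group `Δ = E.geom` has only countably many open subgroups (e.g. `Δ` topologically finitely
generated, [AbsTopI] Prop. 2.2) and the Galois group `G = E.gal` is Galois-countable (second countable),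
then the arithmetic fundamental group `Π = E.arith` is Galois-countable.
[cite: Mochizuki2012, IUTchI Rmk 2.5.3 (ii) (E2) p.53] -/
theorem secondCountableTopology_arith (E : FundamentalExtension.{u})
    (hΔ : {U : Subgroup E.geom | IsOpen (U : Set E.geom)}.Countable) [SecondCountableTopology E.gal] :
    SecondCountableTopology E.arith :=
  secondCountableTopology_of_extension E.aug hΔ

end FundamentalExtension

end Literature.AnabelianGeometry.AbsoluteAnabelian
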